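import Mathlib.Analysis.InnerProductSpace.Calculus
import Mathlib.Geometry.Manifold.ContMDiff.NormedSpace
import Literature.Topology.FourManifolds.ConnectedSum
import HarnessLib

/-!
# Connected sum data: centred charts, the disc inversion and the gluing map

Definitions and lemmas from which `Literature.Topology.FourManifolds.ConnectedSumExistence` proves
the named fact `Literature.Topology.FourManifolds.exists_isConnectedSum` (`Literature.Topology.FourManifolds.exists_isConnectedSum_holds`: existence of
connected sums of closed manifolds; Kervaire–Milnor, *Groups of homotopy spheres I*, Ann. of Math.
77 (1963), §2, p. 505; Kosinski, *Differential Manifolds* (1993), Ch. VI §1, Theorem (1.1)). This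
file does not depend on the pushout construction `Literature.Topology.FourManifolds.SmoothGlueData`
(`Literature.Topology.FourManifolds.GluingConstruction`); it provides the two punctured pieces and
the gluing map.

1. *Discs.* Every point `x` of a smooth manifold modelled on an inner product space `E` lies in
   the source of a chart `e` of the maximal `C^∞` atlas with `e.target = univ` and `e x = 0`
   (shrink a chart to a ball and compose with Mathlib's diffeomorphism `univBall : E ≅ ball`),
   `Literature.Topology.FourManifolds.exists_mem_maximalAtlas_target_eq_univ`; the inverse of such a chart is a smooth
   embedding `E → M` (`Literature.Topology.FourManifolds.isSmoothEmbedding_symm_of_target_eq_univ`). These are the disc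
   embeddings ("imbeddings `hᵢ : Rᵐ → Mᵢ`" of Kosinski VI.1) `i₁ = e₁.symm`, `i₂ = e₂.symm` of a
   `Literature.Topology.FourManifolds.ConnectedSumData`.
2. *The identification.* Kervaire–Milnor's relation `i₁ (t • u) ∼ i₂ ((1 - t) • u)`
   (`‖u‖ = 1`, `0 < t < 1`, `Literature.Topology.FourManifolds.connectedSumRel`) is the graph of the diffeomorphism
   `Φ = e₁ ≫ ψ ≫ e₂.symm` where `ψ v = ((1 - ‖v‖) ‖v‖⁻¹) • v` is the smooth involution of the
   punctured unit ball (`Literature.Topology.FourManifolds.discInversion`; Kosinski's `g = h₂ α_m h₁⁻¹` with the unit ball in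
   place of `Rᵐ`), see `Literature.Topology.FourManifolds.ConnectedSumData.connectedSumRel_iff`; its restriction to the punctured
   pieces `M ∖ {i₁ 0}`, `N ∖ {i₂ 0}` is the open partial homeomorphism `Literature.Topology.FourManifolds.ConnectedSumData.φ`
   (positive dimension), smooth with smooth inverse.
3. *Hausdorff.* The graph of the relation is the trace on `(M ∖ {i₁ 0}) × (N ∖ {i₂ 0})` of the
   compact set `{(i₁ (t • u), i₂ ((1 - t) • u)) | ‖u‖ = 1, 0 ≤ t ≤ 1}` (the endpoints `t = 0, 1`
   give the removed centres), hence closed (`Literature.Topology.FourManifolds.ConnectedSumData.isClosed_connectedSumRel`).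
4. *Compact pieces.* `M ∖ i₁ (ball 0 ½)`, `N ∖ i₂ (ball 0 ½)` (`K₁`, `K₂`) are compact.
5. *Dimension `0`.* Points of `0`-manifolds are open (`Literature.Topology.FourManifolds.isOpen_singleton_of_chartedSpace_zero`).
-/

open scoped Manifold ContDiff Topology
open Set Function Metric Module OpenPartialHomeomorph Topology

noncomputable section

namespace Literature.Topology.FourManifolds

/-- Local notation: `𝔼 n` is the model Euclidean space `EuclideanSpace ℝ (Fin n)`. [folklore] -/
local notation "𝔼 " n:arg => EuclideanSpace ℝ (Fin n)

/-! ### Charts onto the whole model space, and discs -/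

section CentredChart

variable {E : Type*} [NormedAddCommGroup E] [InnerProductSpace ℝ E]
  {M : Type*} [TopologicalSpace M] [ChartedSpace E M] [IsManifold 𝓘(ℝ, E) ∞ M]

/-- Every point `x` of a smooth manifold modelled on an inner product space `E` lies in the
source of a chart of the maximal smooth atlas whose target is all of `E` and which sends `x`
to `0`: shrink the preferred chart to a ball around the image of `x` and compose with the
diffeomorphism `ball ≅ E`; these are the "imbeddings `hᵢ : Rᵐ → Mᵢ`" from which Kosinski,
*Differential Manifolds*, VI.1 builds the connected sum. [folklore] -/
theorem exists_mem_maximalAtlas_target_eq_univ (x : M) :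
    ∃ e ∈ IsManifold.maximalAtlas 𝓘(ℝ, E) ∞ M, x ∈ e.source ∧ e.target = univ ∧ e x = 0 := by
  set e₀ := chartAt E x
  obtain ⟨r, hr, hball⟩ := Metric.isOpen_iff.1 e₀.open_target (e₀ x) (mem_chart_target E x)
  set u := univBall (e₀ x) r
  have hut : u.target = ball (e₀ x) r := univBall_target _ hr
  have h₀ := IsManifold.chart_mem_maximalAtlas (I := 𝓘(ℝ, E)) (n := ∞) x
  refine ⟨e₀ ≫ₕ u.symm, ?_, ?_, ?_, ?_⟩
  · apply OpenPartialHomeomorph.mem_maximalAtlas_of_contMDiffOn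
    · rw [trans_source, coe_trans, symm_source, hut]
      exact contDiffOn_univBall_symm.contMDiffOn.comp
        ((contMDiffOn_of_mem_maximalAtlas h₀).mono inter_subset_left) fun y hy => hy.2
    · rw [trans_symm_eq_symm_trans_symm, symm_symm]
      exact (contMDiffOn_symm_of_mem_maximalAtlas h₀).comp contDiff_univBall.contMDiff.contMDiffOn
        fun y hy => hy.2
  · simp only [trans_source, symm_source, hut, mem_inter_iff, mem_chart_source, mem_preimage,
      mem_ball_self hr, and_self, e₀]
  · rw [trans_target, symm_target, univBall_source, univ_inter, eq_univ_iff_forall]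
    intro y
    exact hball (hut ▸ u.map_source (by simp [u]))
  · simp [u, e₀]

end CentredChart

section Disc

variable {𝕜 : Type*} [NontriviallyNormedField 𝕜] {E : Type*} [NormedAddCommGroup E]
  [NormedSpace 𝕜 E] {H : Type*} [TopologicalSpace H] {I : ModelWithCorners 𝕜 E H} {n : ℕ∞ω}
  {M : Type*} [TopologicalSpace M] [ChartedSpace H M]

/-- The inverse of a chart of the maximal `C^n` atlas whose target is the whole model space is a
`C^n` smooth embedding `H → M` (a "disc embedding" `hᵢ : Rᵐ → Mᵢ` as in Kosinski,
*Differential Manifolds*, VI.1). [folklore] -/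
theorem isSmoothEmbedding_symm_of_target_eq_univ {e : OpenPartialHomeomorph M H}
    (he : e ∈ IsManifold.maximalAtlas I n M) (ht : e.target = univ) :
    Manifold.IsSmoothEmbedding I I n e.symm := by
  have hcont : Continuous e.symm :=
    continuousOn_univ.1 (by simpa only [ht] using e.continuousOn_symm)
  refine ⟨Manifold.IsImmersionOfComplement.isImmersion (F := Unit) fun y => ?_,
    (e.symm.to_isOpenEmbedding (by simp [ht])).isEmbedding⟩
  apply Manifold.IsImmersionAtOfComplement.mk_of_continuousAt (equiv := .prodUnique 𝕜 E _)
    hcont.continuousAt (OpenPartialHomeomorph.refl H) e (mem_univ _)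
    (e.map_target (ht ▸ mem_univ y)) (IsManifold.subset_maximalAtlas (by simp)) he
  intro z hz
  have hz' : z ∈ range I := by simpa using hz
  have : I (e (e.symm (I.symm z))) = z := by
    rw [e.right_inv (ht ▸ mem_univ _), I.right_inv hz']
  simpa

end Disc

/-! ### The inversion of the punctured unit disc -/

section Inversion

variable {E : Type*} [NormedAddCommGroup E] [InnerProductSpace ℝ E]

/-- Kervaire–Milnor's identification map of the punctured unit disc, `t • u ↦ (1 - t) • u` for
`‖u‖ = 1`, `0 < t < 1`, i.e. `v ↦ ((1 - ‖v‖) ‖v‖⁻¹) • v` (Kervaire–Milnor 1963, §2, p. 505;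
Kosinski VI.1 uses the equivalent `α`-flip). [cite: KervaireMilnor1963, §2] -/
def discInversionFun (v : E) : E := ((1 - ‖v‖) * ‖v‖⁻¹) • v

/-- `ψ (t • u) = (1 - t) • u` for a unit vector `u` and `t > 0` (Kervaire–Milnor 1963, §2). [cite: KervaireMilnor1963, §2] -/
theorem discInversionFun_smul {u : E} (hu : ‖u‖ = 1) {t : ℝ} (ht : 0 < t) :
    discInversionFun (t • u) = (1 - t) • u := by
  simp only [discInversionFun, norm_smul, Real.norm_eq_abs, abs_of_pos ht, hu, mul_one, smul_smul]
  congr 1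
  field_simp

/-- `‖ψ v‖ = 1 - ‖v‖` on the punctured closed unit disc. [cite: KervaireMilnor1963, §2] -/
theorem norm_discInversionFun {v : E} (hv : v ≠ 0) (hv1 : ‖v‖ ≤ 1) :
    ‖discInversionFun v‖ = 1 - ‖v‖ := by
  have hn : 0 < ‖v‖ := norm_pos_iff.2 hv
  rw [discInversionFun, norm_smul, Real.norm_eq_abs, abs_of_nonneg (by positivity)]
  field_simp

/-- `ψ` is an involution of the punctured open unit disc. [cite: KervaireMilnor1963, §2] -/
theorem discInversionFun_discInversionFun {v : E} (hv : v ≠ 0) (hv1 : ‖v‖ < 1) :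
    discInversionFun (discInversionFun v) = v := by
  have hn : 0 < ‖v‖ := norm_pos_iff.2 hv
  have h1 : discInversionFun v = (1 - ‖v‖) • ‖v‖⁻¹ • v := by rw [discInversionFun, smul_smul]
  rw [h1, discInversionFun_smul (by rw [norm_smul, norm_inv, norm_norm, inv_mul_cancel₀ hn.ne'])
    (by linarith), smul_smul, sub_sub_cancel, mul_inv_cancel₀ hn.ne', one_smul]

/-- `ψ` is smooth away from `0` (the norm is smooth there). [folklore] -/
theorem contDiffAt_discInversionFun {v : E} (hv : v ≠ 0) : ContDiffAt ℝ ∞ discInversionFun v := by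
  have h := contDiffAt_norm ℝ hv (n := ∞)
  exact ((contDiffAt_const.sub h).mul (h.inv (norm_ne_zero_iff.2 hv))).smul contDiffAt_id

/-- `ψ` is smooth on `{v | v ≠ 0}`. [folklore] -/
theorem contDiffOn_discInversionFun : ContDiffOn ℝ ∞ (discInversionFun : E → E) {v | v ≠ 0} :=
  fun _ hv => (contDiffAt_discInversionFun hv).contDiffWithinAt

/-- The inversion of the punctured open unit disc `{v | 0 < ‖v‖ < 1}` as an open partial
homeomorphism of `E`; it is an involution (Kervaire–Milnor 1963, §2). [cite: KervaireMilnor1963, §2] -/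
def discInversion : OpenPartialHomeomorph E E where
  toFun := discInversionFun
  invFun := discInversionFun
  source := (‖·‖) ⁻¹' Ioo 0 1
  target := (‖·‖) ⁻¹' Ioo 0 1
  map_source' v hv := by
    have hv0 : v ≠ 0 := norm_pos_iff.1 hv.1
    simp only [mem_preimage, mem_Ioo, norm_discInversionFun hv0 hv.2.le]
    exact ⟨by linarith [hv.2], by linarith [hv.1]⟩
  map_target' v hv := by
    have hv0 : v ≠ 0 := norm_pos_iff.1 hv.1
    simp only [mem_preimage, mem_Ioo, norm_discInversionFun hv0 hv.2.le]
    exact ⟨by linarith [hv.2], by linarith [hv.1]⟩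
  left_inv' v hv := discInversionFun_discInversionFun (norm_pos_iff.1 hv.1) hv.2
  right_inv' v hv := discInversionFun_discInversionFun (norm_pos_iff.1 hv.1) hv.2
  open_source := isOpen_Ioo.preimage continuous_norm
  open_target := isOpen_Ioo.preimage continuous_norm
  continuousOn_toFun :=
    contDiffOn_discInversionFun.continuousOn.mono fun v hv => mem_setOf.2 (norm_pos_iff.1 hv.1)
  continuousOn_invFun :=
    contDiffOn_discInversionFun.continuousOn.mono fun v hv => mem_setOf.2 (norm_pos_iff.1 hv.1)

/-- Unfolding of `discInversion`. [folklore] -/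
@[simp] theorem discInversion_apply (v : E) : discInversion v = discInversionFun v := rfl

/-- `discInversion` is its own inverse. [cite: KervaireMilnor1963, §2] -/
@[simp] theorem discInversion_symm : (discInversion : OpenPartialHomeomorph E E).symm = discInversion :=
  rfl

/-- The source of `discInversion` is the punctured open unit disc. [folklore] -/
theorem mem_discInversion_source {v : E} : v ∈ discInversion.source ↔ 0 < ‖v‖ ∧ ‖v‖ < 1 :=
  Iff.rfl

/-- The target of `discInversion` is its source. [folklore] -/
theorem discInversion_target : (discInversion : OpenPartialHomeomorph E E).target = discInversion.source :=
  rfl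

/-- `discInversion` is smooth on its source (as a map of the model manifold `E`). [folklore] -/
theorem contMDiffOn_discInversion :
    ContMDiffOn 𝓘(ℝ, E) 𝓘(ℝ, E) ∞ (discInversion : E → E) discInversion.source :=
  (contDiffOn_discInversionFun.mono fun _ hv => mem_setOf.2 (norm_pos_iff.1 hv.1)).contMDiffOn

end Inversion


/-! ### The construction -/

universe u v

section Construction

variable {n : ℕ} {M : Type u} {N : Type v} [TopologicalSpace M] [ChartedSpace (𝔼 n) M]
  [TopologicalSpace N] [ChartedSpace (𝔼 n) N]

variable (n M N) in
/-- The data from which a connected sum `M # N` is built: charts `e₁`, `e₂` of the maximal smooth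
atlases of `M`, `N` whose targets are all of `ℝⁿ`; the discs are `i₁ = e₁.symm`, `i₂ = e₂.symm`
(Kervaire–Milnor 1963, §2; Kosinski, *Differential Manifolds*, VI.1). [cite: KervaireMilnor1963, §2] -/
structure ConnectedSumData where
  /-- a chart of `M` onto `ℝⁿ` -/
  e₁ : OpenPartialHomeomorph M (𝔼 n)
  /-- a chart of `N` onto `ℝⁿ` -/
  e₂ : OpenPartialHomeomorph N (𝔼 n)
  mem_maximalAtlas₁ : e₁ ∈ IsManifold.maximalAtlas (𝓡 n) ∞ M
  mem_maximalAtlas₂ : e₂ ∈ IsManifold.maximalAtlas (𝓡 n) ∞ N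
  target₁ : e₁.target = univ
  target₂ : e₂.target = univ

/-- Nonempty manifolds carry connected sum data (`exists_mem_maximalAtlas_target_eq_univ`).
[folklore] -/
theorem nonempty_connectedSumData [IsManifold (𝓡 n) ∞ M] [IsManifold (𝓡 n) ∞ N] [Nonempty M]
    [Nonempty N] : Nonempty (ConnectedSumData n M N) := by
  obtain ⟨e₁, h₁, -, ht₁, -⟩ := exists_mem_maximalAtlas_target_eq_univ (E := 𝔼 n)
    (Classical.arbitrary M)
  obtain ⟨e₂, h₂, -, ht₂, -⟩ := exists_mem_maximalAtlas_target_eq_univ (E := 𝔼 n)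
    (Classical.arbitrary N)
  exact ⟨⟨e₁, e₂, h₁, h₂, ht₁, ht₂⟩⟩

/-- Points of a `0`-manifold are open (a chart is injective into the one-point space `ℝ⁰`).
[folklore] -/
theorem isOpen_singleton_of_chartedSpace_zero (hn : n = 0) (p : M) : IsOpen ({p} : Set M) := by
  subst hn
  have hnorm : ∀ u : 𝔼 0, ‖u‖ = 0 := fun u => by simp [EuclideanSpace.norm_eq]
  have hsub : ∀ u v : 𝔼 0, u = v := fun u v => by
    rw [← sub_eq_zero, ← norm_eq_zero]; exact hnorm _
  have h : (chartAt (𝔼 0) p).source = {p} := by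
    refine Subset.antisymm (fun q hq => (chartAt (𝔼 0) p).injOn hq (mem_chart_source _ p)
      (hsub _ _)) ?_
    rw [singleton_subset_iff]; exact mem_chart_source _ p
  exact h ▸ (chartAt (𝔼 0) p).open_source

namespace ConnectedSumData

variable (D : ConnectedSumData n M N)

/-- The first disc `i₁ = e₁.symm : ℝⁿ → M`. [cite: KervaireMilnor1963, §2] -/
def i₁ : 𝔼 n → M := D.e₁.symm

/-- The second disc `i₂ = e₂.symm : ℝⁿ → N`. [cite: KervaireMilnor1963, §2] -/
def i₂ : 𝔼 n → N := D.e₂.symm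

/-- The first disc lands in the source of `e₁`. [folklore] -/
theorem i₁_mem (v : 𝔼 n) : D.i₁ v ∈ D.e₁.source := D.e₁.map_target (D.target₁ ▸ mem_univ v)

/-- The second disc lands in the source of `e₂`. [folklore] -/
theorem i₂_mem (v : 𝔼 n) : D.i₂ v ∈ D.e₂.source := D.e₂.map_target (D.target₂ ▸ mem_univ v)

/-- `e₁ ∘ i₁ = id`. [folklore] -/
@[simp] theorem e₁_i₁ (v : 𝔼 n) : D.e₁ (D.i₁ v) = v := D.e₁.right_inv (D.target₁ ▸ mem_univ v)

/-- `e₂ ∘ i₂ = id`. [folklore] -/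
@[simp] theorem e₂_i₂ (v : 𝔼 n) : D.e₂ (D.i₂ v) = v := D.e₂.right_inv (D.target₂ ▸ mem_univ v)

/-- `i₁ ∘ e₁ = id` on the source of `e₁`. [folklore] -/
theorem i₁_e₁ {p : M} (hp : p ∈ D.e₁.source) : D.i₁ (D.e₁ p) = p := D.e₁.left_inv hp

/-- `i₂ ∘ e₂ = id` on the source of `e₂`. [folklore] -/
theorem i₂_e₂ {q : N} (hq : q ∈ D.e₂.source) : D.i₂ (D.e₂ q) = q := D.e₂.left_inv hq

/-- The first disc is continuous. [folklore] -/
theorem continuous_i₁ : Continuous D.i₁ := by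
  have h := D.e₁.continuousOn_symm
  rw [D.target₁] at h
  exact continuousOn_univ.1 h

/-- The second disc is continuous. [folklore] -/
theorem continuous_i₂ : Continuous D.i₂ := by
  have h := D.e₂.continuousOn_symm
  rw [D.target₂] at h
  exact continuousOn_univ.1 h

/-- The discs are smooth embeddings. [folklore] -/
theorem isSmoothEmbedding_i₁ : Manifold.IsSmoothEmbedding 𝓘(ℝ, 𝔼 n) (𝓡 n) ∞ D.i₁ :=
  isSmoothEmbedding_symm_of_target_eq_univ D.mem_maximalAtlas₁ D.target₁

/-- The discs are smooth embeddings. [folklore] -/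
theorem isSmoothEmbedding_i₂ : Manifold.IsSmoothEmbedding 𝓘(ℝ, 𝔼 n) (𝓡 n) ∞ D.i₂ :=
  isSmoothEmbedding_symm_of_target_eq_univ D.mem_maximalAtlas₂ D.target₂

/-- A point of the first coordinate patch with nonzero coordinate is not the centre. [folklore] -/
theorem ne_center₁ {p : M} (hp : p ∈ D.e₁.source) (h0 : D.e₁ p ≠ 0) : p ≠ D.i₁ 0 := by
  rintro rfl
  exact h0 (D.e₁_i₁ 0)

/-- A point of the second coordinate patch with nonzero coordinate is not the centre. [folklore] -/
theorem ne_center₂ {q : N} (hq : q ∈ D.e₂.source) (h0 : D.e₂ q ≠ 0) : q ≠ D.i₂ 0 := by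
  rintro rfl
  exact h0 (D.e₂_i₂ 0)

/-- The transition diffeomorphism `Φ = e₁ ≫ ψ ≫ e₂.symm` between the punctured coordinate discs
`i₁ (B ∖ 0) ⊆ M` and `i₂ (B ∖ 0) ⊆ N` (Kervaire–Milnor 1963, §2). [cite: KervaireMilnor1963, §2] -/
def Φ : OpenPartialHomeomorph M N := D.e₁ ≫ₕ (discInversion ≫ₕ D.e₂.symm)

/-- `Φ = i₂ ∘ ψ ∘ e₁`. [cite: KervaireMilnor1963, §2] -/
theorem Φ_apply (p : M) : D.Φ p = D.i₂ (discInversionFun (D.e₁ p)) := rfl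

/-- `Φ.symm = i₁ ∘ ψ ∘ e₂`. [cite: KervaireMilnor1963, §2] -/
theorem Φ_symm_apply (q : N) : D.Φ.symm q = D.i₁ (discInversionFun (D.e₂ q)) := rfl

/-- The source of `Φ` is the punctured open coordinate disc `i₁ (B ∖ 0)`. [cite: KervaireMilnor1963, §2] -/
theorem mem_Φ_source {p : M} :
    p ∈ D.Φ.source ↔ p ∈ D.e₁.source ∧ 0 < ‖D.e₁ p‖ ∧ ‖D.e₁ p‖ < 1 := by
  simp only [Φ, trans_source, symm_source, D.target₂, preimage_univ, inter_univ, mem_inter_iff,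
    mem_preimage, mem_discInversion_source]

/-- The target of `Φ` is the punctured open coordinate disc `i₂ (B ∖ 0)`. [cite: KervaireMilnor1963, §2] -/
theorem mem_Φ_target {q : N} :
    q ∈ D.Φ.target ↔ q ∈ D.e₂.source ∧ 0 < ‖D.e₂ q‖ ∧ ‖D.e₂ q‖ < 1 := by
  simp only [Φ, trans_target, symm_target, D.target₁, preimage_univ, inter_univ, mem_inter_iff,
    mem_preimage, discInversion_target, mem_discInversion_source, symm_symm]

/-- Smoothness of `e'.symm ∘ ψ ∘ e` on the punctured coordinate disc. [folklore] -/
private theorem contMDiffOn_aux {e : OpenPartialHomeomorph M (𝔼 n)} {e' : OpenPartialHomeomorph N (𝔼 n)}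
    (he : e ∈ IsManifold.maximalAtlas (𝓡 n) ∞ M) (he' : e' ∈ IsManifold.maximalAtlas (𝓡 n) ∞ N)
    (ht' : e'.target = univ) :
    ContMDiffOn (𝓡 n) (𝓡 n) ∞ (e'.symm ∘ discInversion ∘ e)
      (e.source ∩ e ⁻¹' discInversion.source) := by
  have h₃ : ContMDiffOn (𝓡 n) (𝓡 n) ∞ e'.symm univ := ht' ▸ contMDiffOn_symm_of_mem_maximalAtlas he'
  exact h₃.comp (contMDiffOn_discInversion.comp ((contMDiffOn_of_mem_maximalAtlas he).mono
    inter_subset_left) fun p hp => hp.2) fun _ _ => mem_univ _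

/-- `Φ` is smooth on its source. [cite: KervaireMilnor1963, §2] -/
theorem contMDiffOn_Φ : ContMDiffOn (𝓡 n) (𝓡 n) ∞ D.Φ D.Φ.source := by
  have hs : D.Φ.source = D.e₁.source ∩ D.e₁ ⁻¹' discInversion.source := by
    ext p; simp only [mem_Φ_source, mem_inter_iff, mem_preimage, mem_discInversion_source]
  rw [hs]
  exact contMDiffOn_aux D.mem_maximalAtlas₁ D.mem_maximalAtlas₂ D.target₂

/-- `Φ.symm` is smooth on its source. [cite: KervaireMilnor1963, §2] -/
theorem contMDiffOn_Φ_symm : ContMDiffOn (𝓡 n) (𝓡 n) ∞ D.Φ.symm D.Φ.target := by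
  have hs : D.Φ.target = D.e₂.source ∩ D.e₂ ⁻¹' discInversion.source := by
    ext p; simp only [mem_Φ_target, mem_inter_iff, mem_preimage, mem_discInversion_source]
  rw [hs]
  exact contMDiffOn_aux D.mem_maximalAtlas₂ D.mem_maximalAtlas₁ D.target₁

variable [T2Space M] [T2Space N]

/-- The first punctured piece `M ∖ {i₁ 0}`. [cite: KervaireMilnor1963, §2] -/
abbrev A : TopologicalSpace.Opens M := puncture D.i₁

/-- The second punctured piece `N ∖ {i₂ 0}`. [cite: KervaireMilnor1963, §2] -/
abbrev B : TopologicalSpace.Opens N := puncture D.i₂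

omit [T2Space N] in
/-- The source of `Φ` misses the centre `i₁ 0`. [cite: KervaireMilnor1963, §2] -/
theorem Φ_source_subset : D.Φ.source ⊆ D.A := fun p hp => by
  rw [mem_Φ_source] at hp
  exact D.ne_center₁ hp.1 (norm_pos_iff.1 hp.2.1)

omit [T2Space M] in
/-- The target of `Φ` misses the centre `i₂ 0`. [cite: KervaireMilnor1963, §2] -/
theorem Φ_target_subset : D.Φ.target ⊆ D.B := fun q hq => by
  rw [mem_Φ_target] at hq
  exact D.ne_center₂ hq.1 (norm_pos_iff.1 hq.2.1)

/-- **The connected sum relation is the graph of `Φ`.** For `a ∈ M ∖ {i₁ 0}`, `b ∈ N ∖ {i₂ 0}`: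
`connectedSumRel i₁ i₂ a b ↔ a ∈ Φ.source ∧ Φ a = b` (write `e₁ a = t • u` with `‖u‖ = 1`,
`t = ‖e₁ a‖`) (Kervaire–Milnor 1963, §2). [cite: KervaireMilnor1963, §2] -/
theorem connectedSumRel_iff (a : D.A) (b : D.B) :
    connectedSumRel D.i₁ D.i₂ a b ↔ (a : M) ∈ D.Φ.source ∧ D.Φ a = b := by
  constructor
  · rintro ⟨u, t, hu, ht, ha, hb⟩
    have hv : ‖t • u‖ = t := by rw [norm_smul, Real.norm_eq_abs, abs_of_pos ht.1, hu, mul_one]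
    have ha' : (a : M) ∈ D.e₁.source := ha ▸ D.i₁_mem _
    have hea : D.e₁ a = t • u := by rw [ha, D.e₁_i₁]
    refine ⟨D.mem_Φ_source.2 ⟨ha', ?_, ?_⟩, ?_⟩
    · rw [hea, hv]; exact ht.1
    · rw [hea, hv]; exact ht.2
    · rw [Φ_apply, hea, discInversionFun_smul hu ht.1, hb]
  · rintro ⟨hs, hΦ⟩
    obtain ⟨ha', h0, h1⟩ := D.mem_Φ_source.1 hs
    set v := D.e₁ a with hv
    have hn0 : ‖v‖ ≠ 0 := h0.ne'
    have hu : ‖‖v‖⁻¹ • v‖ = 1 := by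
      rw [norm_smul, norm_inv, norm_norm, inv_mul_cancel₀ hn0]
    have hvu : ‖v‖ • ‖v‖⁻¹ • v = v := by rw [smul_smul, mul_inv_cancel₀ hn0, one_smul]
    refine ⟨‖v‖⁻¹ • v, ‖v‖, hu, ⟨h0, h1⟩, ?_, ?_⟩
    · rw [hvu, hv, D.i₁_e₁ ha']
    · rw [← hΦ, Φ_apply, ← discInversionFun_smul hu h0, hvu]

/-- **The graph of the connected sum relation is closed** in `(M ∖ {i₁ 0}) × (N ∖ {i₂ 0})`: it is
the trace of the compact set `{(i₁ (t • u), i₂ ((1 - t) • u)) | ‖u‖ = 1, 0 ≤ t ≤ 1} ⊆ M × N`,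
whose extra points `t = 0`, `t = 1` have a removed centre as a coordinate (the unit sphere of
`ℝⁿ` is compact). This is where puncturing makes `M # N` Hausdorff (Kosinski VI.1, proof of
(1.1): "the identification of `h₁(x, t)` with `h₂(x, t)` yields in general a non-Hausdorff
manifold!"). [cite: KervaireMilnor1963, §2] [cite: Kosinski1993, Ch. VI §1, (1.1)] -/
theorem isClosed_connectedSumRel :
    IsClosed {p : D.A × D.B | connectedSumRel D.i₁ D.i₂ p.1 p.2} := by
  set g : (𝔼 n) × ℝ → M × N := fun q => (D.i₁ (q.2 • q.1), D.i₂ ((1 - q.2) • q.1)) with hg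
  have hgc : Continuous g :=
    (D.continuous_i₁.comp (continuous_snd.smul continuous_fst)).prodMk
      (D.continuous_i₂.comp ((continuous_const.sub continuous_snd).smul continuous_fst))
  set K := g '' (sphere (0 : 𝔼 n) 1 ×ˢ Icc (0 : ℝ) 1) with hK
  have hKc : IsCompact K := ((isCompact_sphere 0 1).prod isCompact_Icc).image hgc
  have heq : {p : D.A × D.B | connectedSumRel D.i₁ D.i₂ p.1 p.2} =
      (fun p : D.A × D.B => ((p.1 : M), (p.2 : N))) ⁻¹' K := by
    ext ⟨a, b⟩
    simp only [mem_setOf_eq, mem_preimage, hK, mem_image, mem_prod, mem_sphere_zero_iff_norm,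
      mem_Icc, hg, Prod.mk.injEq, Prod.exists]
    constructor
    · rintro ⟨u, t, hu, ht, ha, hb⟩
      exact ⟨u, t, ⟨hu, ht.1.le, ht.2.le⟩, ha.symm, hb.symm⟩
    · rintro ⟨u, t, ⟨hu, h0, h1⟩, ha, hb⟩
      have ht0 : t ≠ 0 := by
        rintro rfl
        exact a.2 (by rw [mem_singleton_iff, ← ha, zero_smul])
      have ht1 : t ≠ 1 := by
        rintro rfl
        exact b.2 (by rw [mem_singleton_iff, ← hb, sub_self, zero_smul])
      exact ⟨u, t, hu, ⟨lt_of_le_of_ne h0 (Ne.symm ht0), lt_of_le_of_ne h1 ht1⟩, ha.symm, hb.symm⟩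
  rw [heq]
  exact hKc.isClosed.preimage (by fun_prop)

/-! #### Positive dimension: the gluing map on the punctured pieces -/

omit [T2Space N] in
/-- In positive dimension the punctured piece `M ∖ {i₁ 0}` is nonempty. [folklore] -/
theorem nonempty_A (hn : n ≠ 0) : Nonempty D.A := by
  obtain ⟨m, rfl⟩ := Nat.exists_eq_succ_of_ne_zero hn
  refine ⟨⟨D.i₁ (EuclideanSpace.single 0 1), D.ne_center₁ (D.i₁_mem _) fun h => ?_⟩⟩
  rw [D.e₁_i₁] at h
  simpa using congrArg (fun v : 𝔼 (m + 1) => v 0) h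

omit [T2Space M] in
/-- In positive dimension the punctured piece `N ∖ {i₂ 0}` is nonempty. [folklore] -/
theorem nonempty_B (hn : n ≠ 0) : Nonempty D.B := by
  obtain ⟨m, rfl⟩ := Nat.exists_eq_succ_of_ne_zero hn
  refine ⟨⟨D.i₂ (EuclideanSpace.single 0 1), D.ne_center₂ (D.i₂_mem _) fun h => ?_⟩⟩
  rw [D.e₂_i₂] at h
  simpa using congrArg (fun v : 𝔼 (m + 1) => v 0) h

/-- The gluing map of the connected sum: `Φ` as an open partial homeomorphism between the
punctured pieces `M ∖ {i₁ 0}` and `N ∖ {i₂ 0}` (which are nonempty in positive dimension).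
[cite: KervaireMilnor1963, §2] -/
def φ (hn : n ≠ 0) : OpenPartialHomeomorph D.A D.B :=
  D.Φ.subtypeRestr (D.nonempty_A hn) ≫ₕ (D.B.openPartialHomeomorphSubtypeCoe (D.nonempty_B hn)).symm

variable (hn : n ≠ 0)

/-- The source of `φ` is that of `Φ`. [folklore] -/
theorem mem_φ_source {a : D.A} : a ∈ (D.φ hn).source ↔ (a : M) ∈ D.Φ.source := by
  simp only [φ, trans_source, subtypeRestr_source, mem_preimage, symm_source,
    TopologicalSpace.Opens.openPartialHomeomorphSubtypeCoe_target, mem_inter_iff, subtypeRestr_coe,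
    restrict_apply, SetLike.mem_coe, and_iff_left_iff_imp]
  exact fun h => D.Φ_target_subset (D.Φ.map_source h)

/-- `φ` is `Φ` on the punctured piece. [folklore] -/
theorem coe_φ {a : D.A} (ha : a ∈ (D.φ hn).source) : ((D.φ hn a : D.B) : N) = D.Φ a := by
  have h : D.Φ a ∈ (D.B.openPartialHomeomorphSubtypeCoe (D.nonempty_B hn)).target := by
    rw [TopologicalSpace.Opens.openPartialHomeomorphSubtypeCoe_target]
    exact D.Φ_target_subset (D.Φ.map_source ((D.mem_φ_source hn).1 ha))
  exact (D.B.openPartialHomeomorphSubtypeCoe (D.nonempty_B hn)).right_inv h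

/-- The target of `φ` is that of `Φ`. [folklore] -/
theorem mem_φ_target {b : D.B} : b ∈ (D.φ hn).target ↔ (b : N) ∈ D.Φ.target := by
  simp only [φ, trans_target, symm_target, TopologicalSpace.Opens.openPartialHomeomorphSubtypeCoe_source,
    symm_symm, TopologicalSpace.Opens.openPartialHomeomorphSubtypeCoe_coe, univ_inter, mem_preimage,
    subtypeRestr_def, TopologicalSpace.Opens.openPartialHomeomorphSubtypeCoe_target, mem_inter_iff,
    SetLike.mem_coe, and_iff_left_iff_imp]
  exact fun h => D.Φ_source_subset (D.Φ.map_target h)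

/-- `φ.symm` is `Φ.symm` on the punctured piece. [folklore] -/
theorem coe_φ_symm {b : D.B} (hb : b ∈ (D.φ hn).target) :
    (((D.φ hn).symm b : D.A) : M) = D.Φ.symm b := by
  have hb' : (b : N) ∈ (D.Φ.subtypeRestr (D.nonempty_A hn)).target := by
    have := hb
    simp only [φ, trans_target, mem_inter_iff, mem_preimage] at this
    exact this.2
  exact D.Φ.subtypeRestr_symm_apply (D.nonempty_A hn) hb'

/-- The connected sum relation is the gluing relation of `φ`. [cite: KervaireMilnor1963, §2] -/
theorem connectedSumRel_iff_φ (a : D.A) (b : D.B) :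
    connectedSumRel D.i₁ D.i₂ a b ↔ a ∈ (D.φ hn).source ∧ D.φ hn a = b := by
  rw [D.connectedSumRel_iff, D.mem_φ_source hn]
  refine and_congr_right fun ha => ?_
  rw [Subtype.ext_iff, D.coe_φ hn ((D.mem_φ_source hn).2 ha)]

/-- The graph of the gluing map is closed. [cite: KervaireMilnor1963, §2] -/
theorem isClosed_graph_φ : IsClosed {p : D.A × D.B | p.1 ∈ (D.φ hn).source ∧ D.φ hn p.1 = p.2} := by
  convert D.isClosed_connectedSumRel using 2
  ext p
  exact (D.connectedSumRel_iff_φ hn p.1 p.2).symm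

/-! #### Compactness -/

/-- The compact piece `M ∖ i₁ (ball 0 ½)` of the first punctured manifold (Kervaire–Milnor 1963,
§2; it is used to see that `M # N` is compact, which Kosinski VI.(1.1)–(2.2) use tacitly for closed
`Mᵢ`). [cite: KervaireMilnor1963, §2] [cite: Kosinski1993, Ch. VI §1, (1.1)] -/
def K₁ : Set D.A := Subtype.val ⁻¹' (D.e₁.source ∩ D.e₁ ⁻¹' ball 0 2⁻¹)ᶜ

/-- The compact piece `N ∖ i₂ (ball 0 ½)` of the second punctured manifold (Kervaire–Milnor 1963,
§2). [cite: KervaireMilnor1963, §2] [cite: Kosinski1993, Ch. VI §1, (1.1)] -/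
def K₂ : Set D.B := Subtype.val ⁻¹' (D.e₂.source ∩ D.e₂ ⁻¹' ball 0 2⁻¹)ᶜ

omit [T2Space N] in
/-- `M ∖ i₁ (ball 0 ½)` is compact when `M` is. [cite: KervaireMilnor1963, §2] -/
theorem isCompact_K₁ [CompactSpace M] : IsCompact D.K₁ := by
  have hsub : (D.e₁.source ∩ D.e₁ ⁻¹' ball 0 2⁻¹)ᶜ ⊆ (D.A : Set M) := by
    intro p hp h
    rw [mem_singleton_iff] at h
    exact hp ⟨h ▸ D.i₁_mem 0, by rw [mem_preimage, h, D.e₁_i₁]; exact mem_ball_self (by norm_num)⟩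
  have himg : Subtype.val '' D.K₁ = (D.e₁.source ∩ D.e₁ ⁻¹' ball 0 2⁻¹)ᶜ := by
    ext p
    exact ⟨by rintro ⟨a, ha, rfl⟩; exact ha, fun hp => ⟨⟨p, hsub hp⟩, hp, rfl⟩⟩
  rw [Subtype.isCompact_iff, himg]
  exact (D.e₁.isOpen_inter_preimage isOpen_ball).isClosed_compl.isCompact

omit [T2Space M] in
/-- `N ∖ i₂ (ball 0 ½)` is compact when `N` is. [cite: KervaireMilnor1963, §2] -/
theorem isCompact_K₂ [CompactSpace N] : IsCompact D.K₂ := by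
  have hsub : (D.e₂.source ∩ D.e₂ ⁻¹' ball 0 2⁻¹)ᶜ ⊆ (D.B : Set N) := by
    intro p hp h
    rw [mem_singleton_iff] at h
    exact hp ⟨h ▸ D.i₂_mem 0, by rw [mem_preimage, h, D.e₂_i₂]; exact mem_ball_self (by norm_num)⟩
  have himg : Subtype.val '' D.K₂ = (D.e₂.source ∩ D.e₂ ⁻¹' ball 0 2⁻¹)ᶜ := by
    ext p
    exact ⟨by rintro ⟨a, ha, rfl⟩; exact ha, fun hp => ⟨⟨p, hsub hp⟩, hp, rfl⟩⟩
  rw [Subtype.isCompact_iff, himg]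
  exact (D.e₂.isOpen_inter_preimage isOpen_ball).isClosed_compl.isCompact


/-- The gluing map is smooth. [cite: KervaireMilnor1963, §2] -/
theorem contMDiffOn_φ : ContMDiffOn (𝓡 n) (𝓡 n) ∞ (D.φ hn) (D.φ hn).source := by
  intro a ha
  rw [← ContMDiffWithinAt.subtypeVal_comp_iff]
  have h : ContMDiffOn (𝓡 n) (𝓡 n) ∞ (D.Φ ∘ (Subtype.val : D.A → M)) (D.φ hn).source :=
    D.contMDiffOn_Φ.comp contMDiff_subtype_val.contMDiffOn fun a ha => (D.mem_φ_source hn).1 ha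
  exact (h a ha).congr (fun a' ha' => D.coe_φ hn ha') (D.coe_φ hn ha)

/-- The inverse gluing map is smooth. [cite: KervaireMilnor1963, §2] -/
theorem contMDiffOn_φ_symm : ContMDiffOn (𝓡 n) (𝓡 n) ∞ (D.φ hn).symm (D.φ hn).target := by
  intro b hb
  rw [← ContMDiffWithinAt.subtypeVal_comp_iff]
  have h : ContMDiffOn (𝓡 n) (𝓡 n) ∞ (D.Φ.symm ∘ (Subtype.val : D.B → N)) (D.φ hn).target :=
    D.contMDiffOn_Φ_symm.comp contMDiff_subtype_val.contMDiffOn fun b hb => (D.mem_φ_target hn).1 hb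
  exact (h b hb).congr (fun b' hb' => D.coe_φ_symm hn hb') (D.coe_φ_symm hn hb)

end ConnectedSumData

end Construction

end Literature.Topology.FourManifolds
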